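import Summits.QuantumFields.YangMills.Theorems.AtomicCalibrationRDistFat
import Summits.QuantumFields.YangMills.Theorems.AtomicCalibrationRGridPartition
import Summits.QuantumFields.YangMills.Theorems.AtomicCalibrationRBandCount
import Summits.QuantumFields.YangMills.Theorems.LangevinControlUVOSLegsFromFemtoAndGapStubLowerBump

/-!
# AtomicCalibrationR (stmt-QuantumFields-28169), E2 `stub_offDiagonalWhitney` — geometry ↔ integers for the band count
# (Plan A step 6 `card_assigned_le` of planner ym-idea-11 g15's `STUB-PLAN-offDiagonalWhitney.md`; prover w4 g22, free hands)

Bridges the grid (`AtomicCalibrationRGridPartition.gridCentre`), the fat-diagonal distance (`AtomicCalibrationRDistFat.distFat`)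
and the discrete count (`AtomicCalibrationRBandCount.nearPairBox`): a grid cube of mesh `h` whose centre lies within `δ` of the
coincidence locus (`distFat (centre) ≤ δ`) and within sup-norm radius `r` of the origin has its multi-index in
`nearPairBox n ⌈r/h⌉₊ ⌈δ/h⌉₊`; hence (`card_nearPairBox_le`) there are at most `n² (2⌈δ/h⌉₊+1)⁴ (2⌈r/h⌉₊+1)^{4n−4}` of them,
and per unit shell `⌊‖centre‖⌋₊ = a` at most `n² (2⌈δ/h⌉₊+1)⁴ (3/h)^{4n−4} (2+a)^{4n−4}` (`ncard_near_shell_le`, the count hypothesis of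
`AtomicCalibrationRShellSum`).

No stub/crux/rung/summit is closed; nothing here touches Yang–Mills; the YM mass gap is NOT proved. [folklore]
-/

set_option autoImplicit false

noncomputable section

open Set
open Summit.QuantumFields.YangMills.Cruxes.AtomicCalibrationR.OffDiagonalFlatness (distFat distFat_le exists_pair_distFat_eq)
open Summit.QuantumFields.YangMills.Cruxes.AtomicCalibrationR.GridPartition (gridCentre gridCentre_apply)
open Summit.QuantumFields.YangMills.Cruxes.AtomicCalibrationR.BandCount (intBox nearPairBox card_nearPairBox_le)
open Summit.QuantumFields.YangMills.Theorems.OSLegsFromFemtoAndGap.StubLower (abs_apply_le_norm)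

namespace Summit.QuantumFields.YangMills.Cruxes.AtomicCalibrationR.BandBridge

/-- Centres within `δ` slotwise force `T`-close integer indices, `T = δ/h`. -/
theorem abs_int_sub_le_of_norm_gridCentre_sub_le {n : ℕ} {h : ℝ} (hh : 0 < h) (c : Fin n × Fin 4 → ℤ)
    {l l' : Fin n} {δ : ℝ} (hδ : ‖gridCentre n h c l - gridCentre n h c l'‖ ≤ δ) (i : Fin 4) :
    |((c (l, i) : ℤ) : ℝ) - c (l', i)| ≤ δ / h := by
  have h1 := (abs_apply_le_norm (gridCentre n h c l - gridCentre n h c l') i).trans hδ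
  have h2 : (gridCentre n h c l - gridCentre n h c l') i = h * ((c (l, i) : ℝ) - c (l', i)) := by
    simp only [PiLp.sub_apply, gridCentre_apply]; ring
  rw [h2, abs_mul, abs_of_pos hh] at h1
  rw [le_div_iff₀ hh, mul_comm]
  exact h1

/-- A centre within sup-norm radius `r` has indices `|c_q| ≤ r/h`. -/
theorem abs_int_le_of_norm_gridCentre_le {n : ℕ} {h : ℝ} (hh : 0 < h) (c : Fin n × Fin 4 → ℤ) {r : ℝ}
    (hr : ‖gridCentre n h c‖ ≤ r) (q : Fin n × Fin 4) : |((c q : ℤ) : ℝ)| ≤ r / h := by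
  have h1 : |gridCentre n h c q.1 q.2| ≤ r :=
    ((abs_apply_le_norm _ q.2).trans (norm_le_pi_norm _ q.1)).trans hr
  rw [gridCentre_apply, abs_mul, abs_of_pos hh] at h1
  rw [le_div_iff₀ hh, mul_comm]
  exact h1

/-- **Geometry → integers.**  For `n ≥ 2`: a grid cube of mesh `h > 0` with `distFat (centre) ≤ δ` and `‖centre‖ ≤ r` has its
multi-index in `nearPairBox n ⌈r/h⌉₊ ⌈δ/h⌉₊`. -/
theorem mem_nearPairBox_of_distFat_le {n : ℕ} (hn : 2 ≤ n) {h : ℝ} (hh : 0 < h) (c : Fin n × Fin 4 → ℤ) {δ r : ℝ}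
    (hδ : distFat (gridCentre n h c) ≤ δ) (hr : ‖gridCentre n h c‖ ≤ r) :
    c ∈ nearPairBox n ⌈r / h⌉₊ ⌈δ / h⌉₊ := by
  obtain ⟨l, l', hll', heq⟩ := exists_pair_distFat_eq hn (gridCentre n h c)
  rw [nearPairBox, Finset.mem_filter]
  refine ⟨?_, l, l', hll', fun i => ?_⟩
  · rw [intBox, Fintype.mem_piFinset]
    intro q
    have hq := (abs_int_le_of_norm_gridCentre_le hh c hr q).trans (Nat.le_ceil (r / h))
    have hq' : |c q| ≤ (⌈r / h⌉₊ : ℤ) := by exact_mod_cast hq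
    exact Finset.mem_Icc.2 (abs_le.1 hq')
  · have hnear : ‖gridCentre n h c l - gridCentre n h c l'‖ ≤ δ := heq ▸ hδ
    have hi := (abs_int_sub_le_of_norm_gridCentre_sub_le hh c hnear i).trans (Nat.le_ceil (δ / h))
    exact_mod_cast hi

/-- **`card_assigned_le`, geometric form.**  For `n ≥ 2`, mesh `h > 0`, the multi-indices of cubes with
`distFat (centre) ≤ δ` and `‖centre‖ ≤ r` form a finite set of cardinality
`≤ n² (2⌈δ/h⌉₊+1)⁴ (2⌈r/h⌉₊+1)^{4n−4}`. [folklore] -/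
theorem ncard_near_le {n : ℕ} (hn : 2 ≤ n) {h : ℝ} (hh : 0 < h) (δ r : ℝ) :
    {c : Fin n × Fin 4 → ℤ | distFat (gridCentre n h c) ≤ δ ∧ ‖gridCentre n h c‖ ≤ r}.ncard ≤
      n ^ 2 * ((2 * ⌈δ / h⌉₊ + 1) ^ 4 * (2 * ⌈r / h⌉₊ + 1) ^ (4 * n - 4)) := by
  have hsub : {c : Fin n × Fin 4 → ℤ | distFat (gridCentre n h c) ≤ δ ∧ ‖gridCentre n h c‖ ≤ r} ⊆
      ↑(nearPairBox n ⌈r / h⌉₊ ⌈δ / h⌉₊) := fun c hc => mem_nearPairBox_of_distFat_le hn hh c hc.1 hc.2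
  calc {c : Fin n × Fin 4 → ℤ | distFat (gridCentre n h c) ≤ δ ∧ ‖gridCentre n h c‖ ≤ r}.ncard
      ≤ (↑(nearPairBox n ⌈r / h⌉₊ ⌈δ / h⌉₊) : Set (Fin n × Fin 4 → ℤ)).ncard :=
        Set.ncard_le_ncard hsub (Finset.finite_toSet _)
    _ = (nearPairBox n ⌈r / h⌉₊ ⌈δ / h⌉₊).card := Set.ncard_coe_finset _
    _ ≤ _ := card_nearPairBox_le n _ _

/-- The same set is finite (so sums over it are finite sums). -/
theorem finite_near {n : ℕ} (hn : 2 ≤ n) {h : ℝ} (hh : 0 < h) (δ r : ℝ) :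
    {c : Fin n × Fin 4 → ℤ | distFat (gridCentre n h c) ≤ δ ∧ ‖gridCentre n h c‖ ≤ r}.Finite :=
  (Finset.finite_toSet _).subset fun c hc => mem_nearPairBox_of_distFat_le hn hh c hc.1 hc.2


/-- Ceiling bookkeeping: for `0 < h ≤ 1`, `2⌈(a+1)/h⌉₊ + 1 ≤ 3(2+a)/h`. -/
theorem two_mul_ceil_add_one_le {h : ℝ} (hh : 0 < h) (hh1 : h ≤ 1) (a : ℕ) :
    (2 * ⌈((a : ℝ) + 1) / h⌉₊ + 1 : ℝ) ≤ 3 * (2 + a) / h := by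
  have hceil : (⌈((a : ℝ) + 1) / h⌉₊ : ℝ) < ((a : ℝ) + 1) / h + 1 := Nat.ceil_lt_add_one (by positivity)
  rw [le_div_iff₀ hh]
  have h1 : (((a : ℝ) + 1) / h) * h = (a : ℝ) + 1 := div_mul_cancel₀ _ hh.ne'
  have ha : (0 : ℝ) ≤ a := Nat.cast_nonneg a
  nlinarith

/-- **Shell form of the band count** (the `A (2+a)^D` hypothesis of `AtomicCalibrationRShellSum`): for `n ≥ 2`, `0 < h ≤ 1`,
the cubes with `distFat (centre) ≤ δ` in the unit shell `⌊‖centre‖⌋₊ = a` number at most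
`n² (2⌈δ/h⌉₊+1)⁴ (3/h)^{4n−4} · (2+a)^{4n−4}`. -/
theorem ncard_near_shell_le {n : ℕ} (hn : 2 ≤ n) {h : ℝ} (hh : 0 < h) (hh1 : h ≤ 1) (δ : ℝ) (a : ℕ) :
    ({c : Fin n × Fin 4 → ℤ | distFat (gridCentre n h c) ≤ δ ∧ ⌊‖gridCentre n h c‖⌋₊ = a}.ncard : ℝ) ≤
      (n : ℝ) ^ 2 * (2 * ⌈δ / h⌉₊ + 1) ^ 4 * (3 / h) ^ (4 * n - 4) * (2 + a) ^ (4 * n - 4) := by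
  have hsub : {c : Fin n × Fin 4 → ℤ | distFat (gridCentre n h c) ≤ δ ∧ ⌊‖gridCentre n h c‖⌋₊ = a} ⊆
      {c : Fin n × Fin 4 → ℤ | distFat (gridCentre n h c) ≤ δ ∧ ‖gridCentre n h c‖ ≤ (a : ℝ) + 1} := by
    rintro c ⟨h1, h2⟩
    refine ⟨h1, ?_⟩
    have := Nat.lt_floor_add_one (‖gridCentre n h c‖)
    rw [h2] at this
    exact_mod_cast this.le
  have h1 := Set.ncard_le_ncard hsub (finite_near hn hh δ ((a : ℝ) + 1))
  have h2 := ncard_near_le hn hh δ ((a : ℝ) + 1)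
  have h3 : ({c : Fin n × Fin 4 → ℤ | distFat (gridCentre n h c) ≤ δ ∧ ⌊‖gridCentre n h c‖⌋₊ = a}.ncard : ℝ) ≤
      (n : ℝ) ^ 2 * ((2 * ⌈δ / h⌉₊ + 1) ^ 4 * (2 * ⌈((a : ℝ) + 1) / h⌉₊ + 1) ^ (4 * n - 4)) := by
    exact_mod_cast h1.trans h2
  refine h3.trans ?_
  have hc := two_mul_ceil_add_one_le hh hh1 a
  have h0 : (0 : ℝ) ≤ 2 * ⌈((a : ℝ) + 1) / h⌉₊ + 1 := by positivity
  have hpow : ((2 * ⌈((a : ℝ) + 1) / h⌉₊ + 1 : ℝ)) ^ (4 * n - 4) ≤ (3 * (2 + a) / h) ^ (4 * n - 4) :=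
    pow_le_pow_left₀ h0 hc _
  calc (n : ℝ) ^ 2 * ((2 * ⌈δ / h⌉₊ + 1) ^ 4 * (2 * ⌈((a : ℝ) + 1) / h⌉₊ + 1) ^ (4 * n - 4))
      ≤ (n : ℝ) ^ 2 * ((2 * ⌈δ / h⌉₊ + 1) ^ 4 * (3 * (2 + a) / h) ^ (4 * n - 4)) :=
        mul_le_mul_of_nonneg_left (mul_le_mul_of_nonneg_left hpow (by positivity)) (by positivity)
    _ = (n : ℝ) ^ 2 * (2 * ⌈δ / h⌉₊ + 1) ^ 4 * (3 / h) ^ (4 * n - 4) * (2 + a) ^ (4 * n - 4) := by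
        rw [show (3 : ℝ) * (2 + a) / h = 3 / h * (2 + a) by ring, mul_pow]; ring

end Summit.QuantumFields.YangMills.Cruxes.AtomicCalibrationR.BandBridge

end
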